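import Summits.CriticalPhenomena.PercolationContinuityZ3.Theorems.PercNearOneGluingNoHeavyLowerTailKnQuestion8CoefficientwiseHalves
import HarnessLib

/-!
# Subdividing an edge: the first rung of `H^{e → u–m–v}` from `H` (with ONE edge-bit) and `H − e`

Support file (`--supports stmt-CriticalPhenomena-4575`, closed), prover `prim-lf-2` (gen 26).  No definitions, no named facts, no sorries; standard axioms.
Memo `prim-lf-2/CW-REDUCTION-gen26.md` §2 (SUBDIVISION LEMMA); companions `…CoefficientwiseDoubling.lean`, `…CoefficientwiseSeries/Decoration/ParallelClosure.lean`.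

The class `𝒞`: `(E; x, z) ∈ 𝒞` iff `0 ≤ Σ_{s ⊆ E : wall} (f(C_x s) − f(C_x(E∖s)))(g(C_x s) − g(C_x(E∖s)))` for all monotone `f, g : Set V → ℝ`
(`C_x(s) = openCluster (ends '' s) x`, wall = `z ∉ C_x(s) ∧ z ∉ C_x(E∖s)`).  The class `𝒞^{(e)}` ('`e` marked') asks the same for the ENRICHED data
`C_x(s) ∪ {m | e ∈ s ∧ u ∈ C_x(s)}`, where `m` is a vertex meeting no edge of `E` that records the bit "`e` belongs to the red edge-cluster of `x`".

(Cluster bookkeeping `mem_openCluster_insert_pendantEdge` / `mem_openCluster_insert_halves` in `…CoefficientwiseHalves.lean`.)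
* `Coefficientwise.cwpa_subdivide` — **SUBDIVISION LEMMA**: with `h₁ = {u,m}`, `h₂ = {m,v}` new edges (`m ∉ {x,z}` meets no edge of `E`), if `(E; x, z) ∈ 𝒞^{(e)}`
  and `(E ∖ {e}; x, z) ∈ 𝒞` then `((E ∖ {e}) ∪ {h₁, h₂}; x, z) ∈ 𝒞`.  Identity behind it (memo §2):
  `T'(G') = T'(H)[F,G] + T'(H−e)[f_u,g_v] + T'(H−e)[f_v,g_u] + Σ Z`, `f_u(W) = f(W ∪ [u∈W]{m})`, with `Z ≥ 0` termwise because `f_u − f_v` and `g_u − g_v`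
  have the same sign pattern.
[cite: KozmaNitzan2024, Questions 8–9 (§5.5 p. 36) (context: first rung of the coefficientwise programme for Question 8)]
-/

namespace Summit.CriticalPhenomena.PercolationContinuityZ3.Theorems

open Finset Literature.Probability.Percolation

namespace Coefficientwise

variable {ι V : Type*} [DecidableEq ι]

open Classical in
/-- **SUBDIVISION LEMMA** (memo `prim-lf-2/CW-REDUCTION-gen26.md` §2).  Let `e ∈ E` have ends `{u,v}` (`u ≠ v`); let `m ∉ {x, z, u, v}` meet no edge of `E`,
and let `h₁, h₂ ∉ E` be two new edges with ends `{u,m}`, `{m,v}`.  Suppose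
(i) `(E; x, z) ∈ 𝒞^{(e)}`: the first rung holds on `E` for all monotone `φ, ψ` evaluated at the enriched clusters `C_x(s) ∪ {m | e ∈ s ∧ u ∈ C_x(s)}`, and
(ii) `(E ∖ {e}; x, z) ∈ 𝒞`.
Then the subdivided multigraph `((E ∖ {e}) ∪ {h₁, h₂}; x, z)` is in `𝒞^{(h₂)}` — the bit of the half `h₂` being carried by an arbitrary second marker
vertex `m'` (data `C_x(s) ∪ {m' | h₂ ∈ s ∧ m ∈ C_x(s)}`; intended use: `m'` a spare vertex); this enriched conclusion is what the thread induction (memo §3)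
iterates, and the plain form `∈ 𝒞` is the case of `φ, ψ` not reading `m'`.  [cite: KozmaNitzan2024, Questions 8–9 (§5.5 p. 36) (context)] -/
theorem cwpa_subdivide (ends : ι → Sym2 V) {E : Finset ι} {e h₁ h₂ : ι} {u v m m' x z : V}
    (he : ends e = s(u, v)) (hh₁ : ends h₁ = s(u, m)) (hh₂ : ends h₂ = s(m, v)) (huv : u ≠ v) (hum : u ≠ m) (hvm : v ≠ m)
    (hxm : x ≠ m) (hzm : z ≠ m) (hmE : ∀ i ∈ E, m ∉ ends i)
    (heE : e ∈ E) (hh₁E : h₁ ∉ E) (hh₂E : h₂ ∉ E) (hh₁₂ : h₁ ≠ h₂)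
    (hH : ∀ φ ψ : Set V → ℝ, Monotone φ → Monotone ψ →
      0 ≤ ∑ s ∈ E.powerset.filter (fun s : Finset ι => z ∉ openCluster (ends '' (↑s : Set ι)) x ∧
            z ∉ openCluster (ends '' (↑(E \ s) : Set ι)) x),
        (φ (openCluster (ends '' (↑s : Set ι)) x ∪ {y | (y = m ∨ y = m') ∧ e ∈ s ∧ u ∈ openCluster (ends '' (↑s : Set ι)) x}) -
            φ (openCluster (ends '' (↑(E \ s) : Set ι)) x ∪
              {y | (y = m ∨ y = m') ∧ e ∈ E \ s ∧ u ∈ openCluster (ends '' (↑(E \ s) : Set ι)) x})) *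
          (ψ (openCluster (ends '' (↑s : Set ι)) x ∪ {y | (y = m ∨ y = m') ∧ e ∈ s ∧ u ∈ openCluster (ends '' (↑s : Set ι)) x}) -
            ψ (openCluster (ends '' (↑(E \ s) : Set ι)) x ∪
              {y | (y = m ∨ y = m') ∧ e ∈ E \ s ∧ u ∈ openCluster (ends '' (↑(E \ s) : Set ι)) x})))
    (hHe : ∀ φ ψ : Set V → ℝ, Monotone φ → Monotone ψ →
      0 ≤ ∑ s ∈ (E.erase e).powerset.filter (fun s : Finset ι => z ∉ openCluster (ends '' (↑s : Set ι)) x ∧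
            z ∉ openCluster (ends '' (↑((E.erase e) \ s) : Set ι)) x),
        (φ (openCluster (ends '' (↑s : Set ι)) x) - φ (openCluster (ends '' (↑((E.erase e) \ s) : Set ι)) x)) *
          (ψ (openCluster (ends '' (↑s : Set ι)) x) - ψ (openCluster (ends '' (↑((E.erase e) \ s) : Set ι)) x)))
    (f g : Set V → ℝ) (hf : Monotone f) (hg : Monotone g) :
    0 ≤ ∑ s ∈ (insert h₁ (insert h₂ (E.erase e))).powerset.filter (fun s : Finset ι => z ∉ openCluster (ends '' (↑s : Set ι)) x ∧
          z ∉ openCluster (ends '' (↑((insert h₁ (insert h₂ (E.erase e))) \ s) : Set ι)) x),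
      (f (openCluster (ends '' (↑s : Set ι)) x ∪ {y | y = m' ∧ h₂ ∈ s ∧ m ∈ openCluster (ends '' (↑s : Set ι)) x}) -
          f (openCluster (ends '' (↑((insert h₁ (insert h₂ (E.erase e))) \ s) : Set ι)) x ∪
            {y | y = m' ∧ h₂ ∈ (insert h₁ (insert h₂ (E.erase e))) \ s ∧
              m ∈ openCluster (ends '' (↑((insert h₁ (insert h₂ (E.erase e))) \ s) : Set ι)) x})) *
        (g (openCluster (ends '' (↑s : Set ι)) x ∪ {y | y = m' ∧ h₂ ∈ s ∧ m ∈ openCluster (ends '' (↑s : Set ι)) x}) -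
          g (openCluster (ends '' (↑((insert h₁ (insert h₂ (E.erase e))) \ s) : Set ι)) x ∪
            {y | y = m' ∧ h₂ ∈ (insert h₁ (insert h₂ (E.erase e))) \ s ∧
              m ∈ openCluster (ends '' (↑((insert h₁ (insert h₂ (E.erase e))) \ s) : Set ι)) x})) := by
  -- notation
  set K : Finset ι → Set V := fun s => openCluster (ends '' (↑s : Set ι)) x with hK
  set E₀ : Finset ι := E.erase e with hE₀
  set E' : Finset ι := insert h₁ (insert h₂ E₀) with hE'
  -- the sections of `f`, `g`
  set fu : Set V → ℝ := fun W => f (W ∪ {y | y = m ∧ u ∈ W}) with hfu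
  set fv : Set V → ℝ := fun W => f (W ∪ {y | (y = m ∨ y = m') ∧ v ∈ W}) with hfv
  set gu : Set V → ℝ := fun W => g (W ∪ {y | y = m ∧ u ∈ W}) with hgu
  set gv : Set V → ℝ := fun W => g (W ∪ {y | (y = m ∨ y = m') ∧ v ∈ W}) with hgv
  have secu_mono : ∀ (φ : Set V → ℝ), Monotone φ → Monotone (fun W : Set V => φ (W ∪ {y | y = m ∧ u ∈ W})) := by
    intro φ hφ W W' hWW'
    exact hφ (Set.union_subset_union hWW' (fun y ⟨hy, hw⟩ => ⟨hy, hWW' hw⟩))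
  have secv_mono : ∀ (φ : Set V → ℝ), Monotone φ → Monotone (fun W : Set V => φ (W ∪ {y | (y = m ∨ y = m') ∧ v ∈ W})) := by
    intro φ hφ W W' hWW'
    exact hφ (Set.union_subset_union hWW' (fun y ⟨hy, hw⟩ => ⟨hy, hWW' hw⟩))
  change 0 ≤ ∑ s ∈ E'.powerset.filter (fun s => z ∉ K s ∧ z ∉ K (E' \ s)),
    (f (K s ∪ {y | y = m' ∧ h₂ ∈ s ∧ m ∈ K s}) - f (K (E' \ s) ∪ {y | y = m' ∧ h₂ ∈ E' \ s ∧ m ∈ K (E' \ s)})) *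
      (g (K s ∪ {y | y = m' ∧ h₂ ∈ s ∧ m ∈ K s}) - g (K (E' \ s) ∪ {y | y = m' ∧ h₂ ∈ E' \ s ∧ m ∈ K (E' \ s)}))
  have hH' : 0 ≤ ∑ s ∈ E.powerset.filter (fun s => z ∉ K s ∧ z ∉ K (E \ s)),
      (f (K s ∪ {y | (y = m ∨ y = m') ∧ e ∈ s ∧ u ∈ K s}) - f (K (E \ s) ∪ {y | (y = m ∨ y = m') ∧ e ∈ E \ s ∧ u ∈ K (E \ s)})) *
        (g (K s ∪ {y | (y = m ∨ y = m') ∧ e ∈ s ∧ u ∈ K s}) - g (K (E \ s) ∪ {y | (y = m ∨ y = m') ∧ e ∈ E \ s ∧ u ∈ K (E \ s)})) :=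
    hH f g hf hg
  have hYuv : 0 ≤ ∑ s ∈ E₀.powerset.filter (fun s => z ∉ K s ∧ z ∉ K (E₀ \ s)),
      (fu (K s) - fu (K (E₀ \ s))) * (gv (K s) - gv (K (E₀ \ s))) := hHe fu gv (secu_mono f hf) (secv_mono g hg)
  have hYvu : 0 ≤ ∑ s ∈ E₀.powerset.filter (fun s => z ∉ K s ∧ z ∉ K (E₀ \ s)),
      (fv (K s) - fv (K (E₀ \ s))) * (gu (K s) - gu (K (E₀ \ s))) := hHe fv gu (secv_mono f hf) (secu_mono g hg)
  -- finset facts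
  have heE₀ : e ∉ E₀ := Finset.notMem_erase e E
  have hE : E = insert e E₀ := (Finset.insert_erase heE).symm
  have hh₁E₀ : h₁ ∉ E₀ := fun h' => hh₁E (Finset.mem_of_mem_erase h')
  have hh₂E₀ : h₂ ∉ E₀ := fun h' => hh₂E (Finset.mem_of_mem_erase h')
  have hh₁E₂ : h₁ ∉ insert h₂ E₀ := by
    rw [Finset.mem_insert, not_or]; exact ⟨hh₁₂, hh₁E₀⟩
  have heh₁ : e ≠ h₁ := fun h' => hh₁E (h' ▸ heE)
  have heh₂ : e ≠ h₂ := fun h' => hh₂E (h' ▸ heE)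
  have hmE₀ : ∀ t, t ⊆ E₀ → ∀ i ∈ t, m ∉ ends i := fun t ht i hi => hmE i (Finset.mem_of_mem_erase (ht hi))
  have hmK : ∀ t, t ⊆ E → m ∉ K t := fun t ht =>
    not_mem_openCluster_of_forall_not_mem ends (fun i hi => hmE i (ht hi)) hxm.symm
  -- complements in `E'` and in `E`, for `t ⊆ E₀`
  have c0 : ∀ t, t ⊆ E₀ → E' \ t = insert h₁ (insert h₂ (E₀ \ t)) := by
    intro t ht; ext i
    simp only [hE', Finset.mem_sdiff, Finset.mem_insert]
    constructor
    · rintro ⟨h | h | h, hnt⟩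
      · exact Or.inl h
      · exact Or.inr (Or.inl h)
      · exact Or.inr (Or.inr ⟨h, hnt⟩)
    · rintro (h | h | ⟨h, hnt⟩)
      · exact ⟨Or.inl h, fun hit => hh₁E₀ (h ▸ ht hit)⟩
      · exact ⟨Or.inr (Or.inl h), fun hit => hh₂E₀ (h ▸ ht hit)⟩
      · exact ⟨Or.inr (Or.inr h), hnt⟩
  have c1 : ∀ t, t ⊆ E₀ → E' \ (insert h₁ t) = insert h₂ (E₀ \ t) := by
    intro t ht; ext i
    simp only [hE', Finset.mem_sdiff, Finset.mem_insert, not_or]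
    constructor
    · rintro ⟨h | h | h, hn1, hnt⟩
      · exact absurd h hn1
      · exact Or.inl h
      · exact Or.inr ⟨h, hnt⟩
    · rintro (h | ⟨h, hnt⟩)
      · exact ⟨Or.inr (Or.inl h), fun h' => hh₁₂ (h'.symm.trans h), fun hit => hh₂E₀ (h ▸ ht hit)⟩
      · exact ⟨Or.inr (Or.inr h), fun h' => hh₁E₀ (h' ▸ h), hnt⟩
  have c2 : ∀ t, t ⊆ E₀ → E' \ (insert h₂ t) = insert h₁ (E₀ \ t) := by
    intro t ht; ext i
    simp only [hE', Finset.mem_sdiff, Finset.mem_insert, not_or]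
    constructor
    · rintro ⟨h | h | h, hn2, hnt⟩
      · exact Or.inl h
      · exact absurd h hn2
      · exact Or.inr ⟨h, hnt⟩
    · rintro (h | ⟨h, hnt⟩)
      · exact ⟨Or.inl h, fun h' => hh₁₂ (h.symm.trans h'), fun hit => hh₁E₀ (h ▸ ht hit)⟩
      · exact ⟨Or.inr (Or.inr h), fun h' => hh₂E₀ (h' ▸ h), hnt⟩
  have c12 : ∀ t, t ⊆ E₀ → E' \ (insert h₁ (insert h₂ t)) = E₀ \ t := by
    intro t ht; ext i
    simp only [hE', Finset.mem_sdiff, Finset.mem_insert, not_or]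
    constructor
    · rintro ⟨h | h | h, hn1, hn2, hnt⟩
      · exact absurd h hn1
      · exact absurd h hn2
      · exact ⟨h, hnt⟩
    · rintro ⟨h, hnt⟩
      exact ⟨Or.inr (Or.inr h), fun h' => hh₁E₀ (h' ▸ h), fun h' => hh₂E₀ (h' ▸ h), hnt⟩
  have cH : ∀ t, t ⊆ E₀ → E \ t = insert e (E₀ \ t) := by
    intro t ht; rw [hE]; ext i
    simp only [Finset.mem_sdiff, Finset.mem_insert]
    constructor
    · rintro ⟨h | h, hnt⟩
      · exact Or.inl h
      · exact Or.inr ⟨h, hnt⟩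
    · rintro (h | ⟨h, hnt⟩)
      · exact ⟨Or.inl h, fun hit => heE₀ (h ▸ ht hit)⟩
      · exact ⟨Or.inr h, hnt⟩
  have cH' : ∀ t, t ⊆ E₀ → E \ (insert e t) = E₀ \ t := by
    intro t ht; rw [hE]; ext i
    simp only [Finset.mem_sdiff, Finset.mem_insert, not_or]
    constructor
    · rintro ⟨h | h, hne, hnt⟩
      · exact absurd h hne
      · exact ⟨h, hnt⟩
    · rintro ⟨h, hnt⟩
      exact ⟨Or.inr h, fun h' => heE₀ (h' ▸ h), hnt⟩
  -- cluster facts for `t ⊆ E₀`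
  have K1 : ∀ t, t ⊆ E₀ → K (insert h₁ t) = K t ∪ {y | y = m ∧ u ∈ K t} := by
    intro t ht; ext y
    rw [Set.mem_union, Set.mem_setOf_eq]
    have := mem_openCluster_insert_pendantEdge ends (t := t) hh₁ hum (hmE₀ t ht) hxm y
    rw [this]; tauto
  have K2 : ∀ t, t ⊆ E₀ → K (insert h₂ t) = K t ∪ {y | y = m ∧ v ∈ K t} := by
    intro t ht; ext y
    rw [Set.mem_union, Set.mem_setOf_eq]
    have hh₂' : ends h₂ = s(v, m) := by rw [hh₂, Sym2.eq_swap]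
    have := mem_openCluster_insert_pendantEdge ends (t := t) hh₂' hvm (hmE₀ t ht) hxm y
    rw [this]; tauto
  have K12 : ∀ t, t ⊆ E₀ → K (insert h₁ (insert h₂ t)) = K (insert e t) ∪ {y | y = m ∧ u ∈ K (insert e t)} := by
    intro t ht; ext y
    rw [Set.mem_union, Set.mem_setOf_eq]
    have := mem_openCluster_insert_halves ends (t := t) he hh₁ hh₂ huv hum hvm (hmE₀ t ht) hxm y
    rw [this]; tauto
  -- enriched data in the four cases
  have hinsE : ∀ t, t ⊆ E₀ → insert e t ⊆ E := fun t ht =>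
    Finset.insert_subset_iff.mpr ⟨heE, fun i hi => Finset.mem_of_mem_erase (ht hi)⟩
  have D12 : ∀ t, t ⊆ E₀ → K (insert h₁ (insert h₂ t)) ∪ {y | y = m' ∧ h₂ ∈ insert h₁ (insert h₂ t) ∧ m ∈ K (insert h₁ (insert h₂ t))} =
      K (insert e t) ∪ {y | (y = m ∨ y = m') ∧ e ∈ insert e t ∧ u ∈ K (insert e t)} := by
    intro t ht
    have hmKe : m ∉ K (insert e t) := hmK _ (hinsE t ht)
    rw [K12 t ht]; ext y
    simp only [Set.mem_union, Set.mem_setOf_eq, Finset.mem_insert, true_or, or_true, true_and]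
    constructor
    · rintro ((hy | ⟨hym, hu⟩) | ⟨hym', hmem⟩)
      · exact Or.inl hy
      · exact Or.inr ⟨Or.inl hym, hu⟩
      · rcases hmem with hmK' | hu
        · exact absurd hmK' hmKe
        · exact Or.inr ⟨Or.inr hym', hu⟩
    · rintro (hy | ⟨hym | hym', hu⟩)
      · exact Or.inl (Or.inl hy)
      · exact Or.inl (Or.inr ⟨hym, hu⟩)
      · exact Or.inr ⟨hym', Or.inr hu⟩
  have D0 : ∀ t, t ⊆ E₀ → K t ∪ {y | y = m' ∧ h₂ ∈ t ∧ m ∈ K t} = K t := by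
    intro t ht; ext y
    rw [Set.mem_union, Set.mem_setOf_eq]
    have : h₂ ∉ t := fun h' => hh₂E₀ (ht h')
    tauto
  have D0H : ∀ t, t ⊆ E₀ → K t ∪ {y | (y = m ∨ y = m') ∧ e ∈ t ∧ u ∈ K t} = K t := by
    intro t ht; ext y
    rw [Set.mem_union, Set.mem_setOf_eq]
    have : e ∉ t := fun h' => heE₀ (ht h')
    tauto
  have D1 : ∀ t, t ⊆ E₀ → K (insert h₁ t) ∪ {y | y = m' ∧ h₂ ∈ insert h₁ t ∧ m ∈ K (insert h₁ t)} = K t ∪ {y | y = m ∧ u ∈ K t} := by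
    intro t ht
    rw [K1 t ht]; ext y
    simp only [Set.mem_union, Set.mem_setOf_eq, Finset.mem_insert]
    have : h₂ ∉ t := fun h' => hh₂E₀ (ht h')
    constructor
    · rintro (hy | ⟨_, hh, _⟩)
      · exact hy
      · rcases hh with hh | hh
        · exact absurd hh.symm hh₁₂
        · exact absurd hh this
    · exact Or.inl
  have D2 : ∀ t, t ⊆ E₀ → K (insert h₂ t) ∪ {y | y = m' ∧ h₂ ∈ insert h₂ t ∧ m ∈ K (insert h₂ t)} =
      K t ∪ {y | (y = m ∨ y = m') ∧ v ∈ K t} := by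
    intro t ht
    have hmKt : m ∉ K t := hmK _ (fun i hi => Finset.mem_of_mem_erase (ht hi))
    rw [K2 t ht]; ext y
    simp only [Set.mem_union, Set.mem_setOf_eq, Finset.mem_insert, true_or, true_and]
    constructor
    · rintro ((hy | ⟨hym, hv⟩) | ⟨hym', hmem⟩)
      · exact Or.inl hy
      · exact Or.inr ⟨Or.inl hym, hv⟩
      · rcases hmem with hmK' | hv
        · exact absurd hmK' hmKt
        · exact Or.inr ⟨Or.inr hym', hv⟩
    · rintro (hy | ⟨hym | hym', hv⟩)
      · exact Or.inl (Or.inl hy)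
      · exact Or.inl (Or.inr ⟨hym, hv⟩)
      · exact Or.inr ⟨hym', Or.inr hv⟩
  have hzS1 : ∀ (X : Set V) (P : Prop), (z ∈ X ∪ {y | y = m ∧ P}) ↔ z ∈ X := by
    intro X P
    rw [Set.mem_union, Set.mem_setOf_eq]
    constructor
    · rintro (h' | ⟨h', _⟩)
      · exact h'
      · exact absurd h' hzm
    · exact Or.inl
  -- the summands
  set T : Finset ι → ℝ := fun s => if z ∉ K s ∧ z ∉ K (E' \ s)
      then (f (K s ∪ {y | y = m' ∧ h₂ ∈ s ∧ m ∈ K s}) - f (K (E' \ s) ∪ {y | y = m' ∧ h₂ ∈ E' \ s ∧ m ∈ K (E' \ s)})) *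
        (g (K s ∪ {y | y = m' ∧ h₂ ∈ s ∧ m ∈ K s}) - g (K (E' \ s) ∪ {y | y = m' ∧ h₂ ∈ E' \ s ∧ m ∈ K (E' \ s)})) else 0 with hT
  set TH : Finset ι → ℝ := fun s => if z ∉ K s ∧ z ∉ K (E \ s)
      then (f (K s ∪ {y | (y = m ∨ y = m') ∧ e ∈ s ∧ u ∈ K s}) - f (K (E \ s) ∪ {y | (y = m ∨ y = m') ∧ e ∈ E \ s ∧ u ∈ K (E \ s)})) *
        (g (K s ∪ {y | (y = m ∨ y = m') ∧ e ∈ s ∧ u ∈ K s}) -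
          g (K (E \ s) ∪ {y | (y = m ∨ y = m') ∧ e ∈ E \ s ∧ u ∈ K (E \ s)})) else 0 with hTH
  set TA : Finset ι → ℝ := fun s => if z ∉ K s ∧ z ∉ K (E₀ \ s)
      then (fu (K s) - fv (K (E₀ \ s))) * (gu (K s) - gv (K (E₀ \ s))) else 0 with hTA
  set TB : Finset ι → ℝ := fun s => if z ∉ K s ∧ z ∉ K (E₀ \ s)
      then (fv (K s) - fu (K (E₀ \ s))) * (gv (K s) - gu (K (E₀ \ s))) else 0 with hTB
  rw [Finset.sum_filter]
  change 0 ≤ ∑ s ∈ E'.powerset, T s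
  rw [hE', Finset.sum_powerset_insert hh₁E₂, Finset.sum_powerset_insert hh₂E₀,
    Finset.sum_congr rfl fun t _ => (rfl : T (insert h₁ t) = T (insert h₁ t)), Finset.sum_powerset_insert hh₂E₀]
  -- identify the four families
  have eA : ∀ t ∈ E₀.powerset, T t = TH t := by
    intro t ht
    have ht' := Finset.mem_powerset.mp ht
    have hK2 : K (E' \ t) ∪ {y | y = m' ∧ h₂ ∈ E' \ t ∧ m ∈ K (E' \ t)} =
        K (E \ t) ∪ {y | (y = m ∨ y = m') ∧ e ∈ E \ t ∧ u ∈ K (E \ t)} := by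
      rw [c0 t ht', cH t ht']; exact D12 (E₀ \ t) Finset.sdiff_subset
    have hK2' : K (E' \ t) = K (E \ t) ∪ {y | y = m ∧ u ∈ K (E \ t)} := by
      rw [c0 t ht', cH t ht']; exact K12 (E₀ \ t) Finset.sdiff_subset
    have hK1 : K t ∪ {y | y = m' ∧ h₂ ∈ t ∧ m ∈ K t} = K t := D0 t ht'
    have hK1' : K t ∪ {y | (y = m ∨ y = m') ∧ e ∈ t ∧ u ∈ K t} = K t := D0H t ht'
    have hcond : (z ∉ K t ∧ z ∉ K (E' \ t)) ↔ (z ∉ K t ∧ z ∉ K (E \ t)) := by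
      rw [hK2']; exact and_congr Iff.rfl (not_congr (hzS1 _ _))
    simp only [hT, hTH]
    by_cases hc : z ∉ K t ∧ z ∉ K (E' \ t)
    · rw [if_pos hc, if_pos (hcond.mp hc), hK1, hK2, hK1']
    · rw [if_neg hc, if_neg (fun h' => hc (hcond.mpr h'))]
  have eD : ∀ t ∈ E₀.powerset, T (insert h₁ (insert h₂ t)) = TH (insert e t) := by
    intro t ht
    have ht' := Finset.mem_powerset.mp ht
    have hK1 : K (insert h₁ (insert h₂ t)) ∪ {y | y = m' ∧ h₂ ∈ insert h₁ (insert h₂ t) ∧ m ∈ K (insert h₁ (insert h₂ t))} =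
        K (insert e t) ∪ {y | (y = m ∨ y = m') ∧ e ∈ insert e t ∧ u ∈ K (insert e t)} := D12 t ht'
    have hK1' : K (insert h₁ (insert h₂ t)) = K (insert e t) ∪ {y | y = m ∧ u ∈ K (insert e t)} := K12 t ht'
    have hK2 : K (E' \ insert h₁ (insert h₂ t)) = K (E \ insert e t) := by rw [c12 t ht', cH' t ht']
    have hK3 : K (E \ insert e t) ∪ {y | (y = m ∨ y = m') ∧ e ∈ E \ insert e t ∧ u ∈ K (E \ insert e t)} = K (E \ insert e t) := by
      rw [cH' t ht']; exact D0H (E₀ \ t) Finset.sdiff_subset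
    have hK4 : K (E' \ insert h₁ (insert h₂ t)) ∪ {y | y = m' ∧ h₂ ∈ E' \ insert h₁ (insert h₂ t) ∧ m ∈ K (E' \ insert h₁ (insert h₂ t))} =
        K (E \ insert e t) := by
      rw [c12 t ht', cH' t ht']; exact D0 (E₀ \ t) Finset.sdiff_subset
    have hcond : (z ∉ K (insert h₁ (insert h₂ t)) ∧ z ∉ K (E' \ insert h₁ (insert h₂ t))) ↔
        (z ∉ K (insert e t) ∧ z ∉ K (E \ insert e t)) := by
      rw [hK1', hK2]; exact and_congr (not_congr (hzS1 _ _)) Iff.rfl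
    simp only [hT, hTH]
    by_cases hc : z ∉ K (insert h₁ (insert h₂ t)) ∧ z ∉ K (E' \ insert h₁ (insert h₂ t))
    · rw [if_pos hc, if_pos (hcond.mp hc), hK1, hK4, hK3]
    · rw [if_neg hc, if_neg (fun h' => hc (hcond.mpr h'))]
  have eB : ∀ t ∈ E₀.powerset, T (insert h₁ t) = TA t := by
    intro t ht
    have ht' := Finset.mem_powerset.mp ht
    have hK1 : K (insert h₁ t) ∪ {y | y = m' ∧ h₂ ∈ insert h₁ t ∧ m ∈ K (insert h₁ t)} = K t ∪ {y | y = m ∧ u ∈ K t} := D1 t ht'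
    have hK1' : K (insert h₁ t) = K t ∪ {y | y = m ∧ u ∈ K t} := K1 t ht'
    have hK2 : K (E' \ insert h₁ t) ∪ {y | y = m' ∧ h₂ ∈ E' \ insert h₁ t ∧ m ∈ K (E' \ insert h₁ t)} =
        K (E₀ \ t) ∪ {y | (y = m ∨ y = m') ∧ v ∈ K (E₀ \ t)} := by
      rw [c1 t ht']; exact D2 (E₀ \ t) Finset.sdiff_subset
    have hK2' : K (E' \ insert h₁ t) = K (E₀ \ t) ∪ {y | y = m ∧ v ∈ K (E₀ \ t)} := by
      rw [c1 t ht']; exact K2 (E₀ \ t) Finset.sdiff_subset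
    have hcond : (z ∉ K (insert h₁ t) ∧ z ∉ K (E' \ insert h₁ t)) ↔ (z ∉ K t ∧ z ∉ K (E₀ \ t)) := by
      rw [hK1', hK2']; exact and_congr (not_congr (hzS1 _ _)) (not_congr (hzS1 _ _))
    simp only [hT, hTA, hfu, hfv, hgu, hgv]
    by_cases hc : z ∉ K (insert h₁ t) ∧ z ∉ K (E' \ insert h₁ t)
    · rw [if_pos hc, if_pos (hcond.mp hc), hK1, hK2]
    · rw [if_neg hc, if_neg (fun h' => hc (hcond.mpr h'))]
  have eC : ∀ t ∈ E₀.powerset, T (insert h₂ t) = TB t := by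
    intro t ht
    have ht' := Finset.mem_powerset.mp ht
    have hK1 : K (insert h₂ t) ∪ {y | y = m' ∧ h₂ ∈ insert h₂ t ∧ m ∈ K (insert h₂ t)} = K t ∪ {y | (y = m ∨ y = m') ∧ v ∈ K t} :=
      D2 t ht'
    have hK1' : K (insert h₂ t) = K t ∪ {y | y = m ∧ v ∈ K t} := K2 t ht'
    have hK2 : K (E' \ insert h₂ t) ∪ {y | y = m' ∧ h₂ ∈ E' \ insert h₂ t ∧ m ∈ K (E' \ insert h₂ t)} =
        K (E₀ \ t) ∪ {y | y = m ∧ u ∈ K (E₀ \ t)} := by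
      rw [c2 t ht']; exact D1 (E₀ \ t) Finset.sdiff_subset
    have hK2' : K (E' \ insert h₂ t) = K (E₀ \ t) ∪ {y | y = m ∧ u ∈ K (E₀ \ t)} := by
      rw [c2 t ht']; exact K1 (E₀ \ t) Finset.sdiff_subset
    have hcond : (z ∉ K (insert h₂ t) ∧ z ∉ K (E' \ insert h₂ t)) ↔ (z ∉ K t ∧ z ∉ K (E₀ \ t)) := by
      rw [hK1', hK2']; exact and_congr (not_congr (hzS1 _ _)) (not_congr (hzS1 _ _))
    simp only [hT, hTB, hfu, hfv, hgu, hgv]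
    by_cases hc : z ∉ K (insert h₂ t) ∧ z ∉ K (E' \ insert h₂ t)
    · rw [if_pos hc, if_pos (hcond.mp hc), hK1, hK2]
    · rw [if_neg hc, if_neg (fun h' => hc (hcond.mpr h'))]
  rw [Finset.sum_congr rfl eA, Finset.sum_congr rfl eB, Finset.sum_congr rfl eC, Finset.sum_congr rfl eD]
  -- (r,r) + (b,b) = T'(H)[F,G]
  have hRR : ∑ t ∈ E₀.powerset, TH t + ∑ t ∈ E₀.powerset, TH (insert e t) = ∑ s ∈ E.powerset, TH s := by
    rw [hE, Finset.sum_powerset_insert heE₀]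
  have hRR0 : 0 ≤ ∑ s ∈ E.powerset, TH s := by rw [← Finset.sum_filter]; exact hH'
  -- (r,b) + (b,r) ≥ the two Y-sums, the remainder Z being termwise ≥ 0
  have sign_gen : ∀ (φ : Set V → ℝ), Monotone φ → ∀ W : Set V,
      (u ∈ W ∧ v ∉ W → 0 ≤ φ (W ∪ {y | y = m ∧ u ∈ W}) - φ (W ∪ {y | (y = m ∨ y = m') ∧ v ∈ W})) ∧
      (v ∈ W → φ (W ∪ {y | y = m ∧ u ∈ W}) - φ (W ∪ {y | (y = m ∨ y = m') ∧ v ∈ W}) ≤ 0) ∧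
      (u ∉ W ∧ v ∉ W → φ (W ∪ {y | y = m ∧ u ∈ W}) - φ (W ∪ {y | (y = m ∨ y = m') ∧ v ∈ W}) = 0) := by
    intro φ hφ W
    refine ⟨fun ⟨hu, hv⟩ => ?_, fun hv => ?_, fun ⟨hu, hv⟩ => ?_⟩
    · rw [sub_nonneg]
      exact hφ (Set.union_subset_union_right W (fun y ⟨_, hv'⟩ => absurd hv' hv))
    · rw [sub_nonpos]
      exact hφ (Set.union_subset_union_right W (fun y ⟨hy, _⟩ => ⟨Or.inl hy, hv⟩))
    · have e1 : {y | y = m ∧ u ∈ W} = ∅ := by ext y; simp [hu]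
      have e2 : {y | (y = m ∨ y = m') ∧ v ∈ W} = ∅ := by ext y; simp [hv]
      rw [e1, e2, sub_self]
  have Znonneg : ∀ W : Set V, 0 ≤ (fu W - fv W) * (gu W - gv W) := by
    intro W
    obtain ⟨f1, f2, f3⟩ := sign_gen f hf W
    obtain ⟨g1, g2, g3⟩ := sign_gen g hg W
    simp only [hfu, hfv, hgu, hgv]
    by_cases hv : v ∈ W
    · exact mul_nonneg_of_nonpos_of_nonpos (f2 hv) (g2 hv)
    · by_cases hu : u ∈ W
      · exact mul_nonneg (f1 ⟨hu, hv⟩) (g1 ⟨hu, hv⟩)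
      · rw [f3 ⟨hu, hv⟩]; simp
  have hXYZ : ∀ t ∈ E₀.powerset, TA t + TB t =
      (if z ∉ K t ∧ z ∉ K (E₀ \ t) then (fu (K t) - fu (K (E₀ \ t))) * (gv (K t) - gv (K (E₀ \ t))) else 0) +
      (if z ∉ K t ∧ z ∉ K (E₀ \ t) then (fv (K t) - fv (K (E₀ \ t))) * (gu (K t) - gu (K (E₀ \ t))) else 0) +
      (if z ∉ K t ∧ z ∉ K (E₀ \ t) then (fu (K t) - fv (K t)) * (gu (K t) - gv (K t)) +
        (fu (K (E₀ \ t)) - fv (K (E₀ \ t))) * (gu (K (E₀ \ t)) - gv (K (E₀ \ t))) else 0) := by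
    intro t _
    simp only [hTA, hTB]
    split_ifs <;> ring
  have hZsum : 0 ≤ ∑ t ∈ E₀.powerset, (if z ∉ K t ∧ z ∉ K (E₀ \ t) then (fu (K t) - fv (K t)) * (gu (K t) - gv (K t)) +
        (fu (K (E₀ \ t)) - fv (K (E₀ \ t))) * (gu (K (E₀ \ t)) - gv (K (E₀ \ t))) else 0) := by
    refine Finset.sum_nonneg fun t _ => ?_
    split_ifs
    · exact add_nonneg (Znonneg _) (Znonneg _)
    · exact le_refl _
  have hAB : ∑ t ∈ E₀.powerset, TA t + ∑ t ∈ E₀.powerset, TB t =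
      ∑ t ∈ E₀.powerset, (if z ∉ K t ∧ z ∉ K (E₀ \ t) then (fu (K t) - fu (K (E₀ \ t))) * (gv (K t) - gv (K (E₀ \ t))) else 0) +
      ∑ t ∈ E₀.powerset, (if z ∉ K t ∧ z ∉ K (E₀ \ t) then (fv (K t) - fv (K (E₀ \ t))) * (gu (K t) - gu (K (E₀ \ t))) else 0) +
      ∑ t ∈ E₀.powerset, (if z ∉ K t ∧ z ∉ K (E₀ \ t) then (fu (K t) - fv (K t)) * (gu (K t) - gv (K t)) +
        (fu (K (E₀ \ t)) - fv (K (E₀ \ t))) * (gu (K (E₀ \ t)) - gv (K (E₀ \ t))) else 0) := by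
    rw [← Finset.sum_add_distrib, ← Finset.sum_add_distrib, ← Finset.sum_add_distrib]
    exact Finset.sum_congr rfl hXYZ
  have hY1 : 0 ≤ ∑ t ∈ E₀.powerset, (if z ∉ K t ∧ z ∉ K (E₀ \ t)
      then (fu (K t) - fu (K (E₀ \ t))) * (gv (K t) - gv (K (E₀ \ t))) else 0) := by
    rw [← Finset.sum_filter]; exact hYuv
  have hY2 : 0 ≤ ∑ t ∈ E₀.powerset, (if z ∉ K t ∧ z ∉ K (E₀ \ t)
      then (fv (K t) - fv (K (E₀ \ t))) * (gu (K t) - gu (K (E₀ \ t))) else 0) := by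
    rw [← Finset.sum_filter]; exact hYvu
  linarith

end Coefficientwise

end Summit.CriticalPhenomena.PercolationContinuityZ3.Theorems
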